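import Literature.NumberTheory.EllipticCurves.Tian2014.CMPointSystemBridgeDisplays
import Literature.NumberTheory.EllipticCurves.TwoDescentRankBounds
import Mathlib.Analysis.Real.Sqrt
import Mathlib.Data.Complex.Basic
import Mathlib.LinearAlgebra.Matrix.Notation
import HarnessLib

/-!
# Arithmetic behind PROOF-A Lemma 8.1, step (8.1.2): Tian's matrices `A = (0 1; −32 0)`, `B = (1 1/4; 0 1)`
# acting on the upper half plane, TYZ's CM point `h = i/(4√N)` (`N = 2n`), the two identities `A·h = i√N/8`,
# `B·(i√N/8) = (2 + i√N)/8`; and `E[2] = {0, (0,0), (±1,0)}` over any field of characteristic `0`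

Cell `bsd-monsky` (prover-A seat, g7). Support file of `Tian2014/CMPointSystemBridgeMaximal.lean` (the displays
of Tian 2014 Prop. 2.1 / TYZ 2017 §3.1 and the kernel proof of the point identification (8.1.4)). Everything here is
PROVED; no named fact, nothing displayed:

* `moebius g z = (az + b)/(cz + d)` (Lean's `x/0 = 0` off the domain), the matrices `matA`, `matB` of Tian's
  Prop. 2.1 proof (p0006 L43–L59) and TYZ's embedding matrix `matTYZ N = (0 1/4; −4N 0)` (p0010 L84–L89);
  `hPoint N = i/(4√N)` is its fixed point in `ℋ` (`moebius_fixedPoint_hPoint`, `hPoint_im_pos`) — the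
  transcription of TYZ's `h` («the unique fixed point of `K_n^×` in `ℋ`») is certified, not displayed;
* the two `2 × 2` matrix identities of PROOF-A v3.4 (8.1.2): `moebius_matA_hPoint` (`A·h = i√N/8`) and
  `moebius_matB_eq` (`B·(i√N/8) = (2 + i√N)/8`), with `i√N/8 ∈ ℋ` (`im_I_mul_sqrt_div_pos`);
* `E : y² = x³ − x` has split `2`-torsion `0, 1, −1` over every field of characteristic `0`
  (`splitTwoTorsion_E`), so `E(H)[2] = {0, (0,0), (1,0), (−1,0)}` (`eq_twoTorsion_of_two_nsmul_eq_zero`, from the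
  tree's `eq_zero_or_eq_twoTorsion_of_two_nsmul_eq_zero`), and the four points are fixed by every `ℚ`-algebra
  map `H → K` (`map_ptZero`, `map_ptOne`, `map_ptNegOne`).
[cite: Tian2014, Prop. 2.1 proof (p0006 L43–L59), §2 (p0006 L4–L19)] [cite: TianYuanZhang2017, §3.1 (p0010 L84–L89)]
[cite: SilvermanAEC2009, Prop. X.1.4]
-/

noncomputable section

open scoped Classical

open WeierstrassCurve NumberField Literature.NumberTheory.EllipticCurves
  Literature.NumberTheory.EllipticCurves.TianYuanZhang2017

namespace Literature.NumberTheory.EllipticCurves.Tian2014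

/-! ## §1 Möbius transformations and the two matrices of Tian's Prop. 2.1 -/

/-- The action `γ·z = (az + b)/(cz + d)` of a `2 × 2` complex matrix on `ℂ` (Lean's `x/0 = 0` off the domain).
[cite: Tian2014, §2 (p0006 L4–L13: `GL₂⁺(ℝ)` acts on `ℋ` by linear fractional transformations)] -/
def moebius (g : Matrix (Fin 2) (Fin 2) ℂ) (z : ℂ) : ℂ := (g 0 0 * z + g 0 1) / (g 1 0 * z + g 1 1)

/-- Tian's matrix `A = (0 1; −32 0)`. [cite: Tian2014, Prop. 2.1 proof (p0006 L43–L48)] -/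
def matA : Matrix (Fin 2) (Fin 2) ℂ := !![0, 1; -32, 0]

/-- Tian's matrix `B = (1 1/4; 0 1)`. [cite: Tian2014, Prop. 2.1 proof (p0006 L49–L53)] -/
def matB : Matrix (Fin 2) (Fin 2) ℂ := !![1, 1 / 4; 0, 1]

/-- TYZ's embedding matrix for `n ≡ 6 (mod 8)`: `√−n ↦ (0 1/4; −4n 0)` (here with `n = N = 2·n_Tian`).
[cite: TianYuanZhang2017, §3.1 (p0010 L84–L89)] -/
def matTYZ (N : ℕ) : Matrix (Fin 2) (Fin 2) ℂ := !![0, 1 / 4; -(4 * (N : ℂ)), 0]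

/-- `A·z = −1/(32z)` for Tian's `A = (0 1; −32 0)`. [cite: Tian2014, Prop. 2.1 proof (p0006 L43–L48)] [folklore] -/
theorem moebius_matA (z : ℂ) : moebius matA z = -1 / (32 * z) := by
  simp only [moebius, matA, Matrix.of_apply, Matrix.cons_val', Matrix.cons_val_zero, Matrix.cons_val_one,
    Matrix.cons_val_fin_one, Matrix.empty_val', zero_mul, zero_add, add_zero]
  by_cases hz : z = 0
  · simp [hz]
  · field_simp

/-- `B·z = z + 1/4` for Tian's `B = (1 1/4; 0 1)`. [cite: Tian2014, Prop. 2.1 proof (p0006 L49–L53)] [folklore] -/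
theorem moebius_matB (z : ℂ) : moebius matB z = z + 1 / 4 := by
  simp [moebius, matB]

/-- TYZ's `h` for `n ≡ 6 (mod 8)`, `N = 2n`: `h = i/(4√N)`, the fixed point in `ℋ` of `√−N ↦ (0 1/4; −4N 0)`
(`h = −1/(16Nh)`, i.e. `h² = −1/(16N)`). [cite: TianYuanZhang2017, §3.1 (p0010 L84–L89)] -/
def hPoint (N : ℕ) : ℂ := Complex.I / (4 * (Real.sqrt N : ℂ))

/-- `√N > 0` for `N ≠ 0` (plumbing). [folklore] -/
private theorem sqrt_natCast_pos {N : ℕ} (hN : N ≠ 0) : (0 : ℝ) < Real.sqrt N :=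
  Real.sqrt_pos.mpr (by exact_mod_cast Nat.pos_of_ne_zero hN)

/-- `√N ≠ 0` in `ℂ` for `N ≠ 0` (plumbing). [folklore] -/
private theorem sqrt_natCast_ne_zero {N : ℕ} (hN : N ≠ 0) : (Real.sqrt N : ℂ) ≠ 0 := by
  exact_mod_cast (sqrt_natCast_pos hN).ne'

/-- `(√N)² = N` in `ℂ` (plumbing). [folklore] -/
private theorem sq_sqrt_natCast (N : ℕ) : (Real.sqrt N : ℂ) ^ 2 = (N : ℂ) := by
  rw [← Complex.ofReal_pow, Real.sq_sqrt (Nat.cast_nonneg N)]; simp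

/-- `h ∈ ℋ`: `Im h = 1/(4√N) > 0`. [cite: TianYuanZhang2017, §3.1 (p0010 L84–L89)] [folklore] -/
theorem hPoint_im_pos {N : ℕ} (hN : N ≠ 0) : 0 < (hPoint N).im := by
  have hs := sqrt_natCast_pos hN
  have : hPoint N = ((4 * Real.sqrt N)⁻¹ : ℝ) * Complex.I := by
    rw [hPoint, div_eq_inv_mul]; push_cast; ring
  rw [this]
  simp only [Complex.mul_im, Complex.ofReal_re, Complex.ofReal_im, Complex.I_re, Complex.I_im, mul_one,
    zero_mul, add_zero]
  positivity

/-- `h ≠ 0`. [cite: TianYuanZhang2017, §3.1 (p0010 L84–L89)] [folklore] -/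
theorem hPoint_ne_zero {N : ℕ} (hN : N ≠ 0) : hPoint N ≠ 0 := by
  have hs := sqrt_natCast_ne_zero hN
  rw [hPoint]
  exact div_ne_zero Complex.I_ne_zero (mul_ne_zero (by norm_num) hs)

/-- `h² = −1/(16N)` in the form `16N·h² = −1`. [cite: TianYuanZhang2017, §3.1 (p0010 L84–L89)] -/
theorem sixteen_mul_sq_hPoint {N : ℕ} (hN : N ≠ 0) : 16 * (N : ℂ) * hPoint N ^ 2 = -1 := by
  have hs := sqrt_natCast_ne_zero hN
  have hsq := sq_sqrt_natCast N
  have hN' : (N : ℂ) ≠ 0 := by exact_mod_cast hN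
  rw [hPoint, div_pow, mul_pow, Complex.I_sq, hsq]
  field_simp
  norm_num

/-- **`h` is the fixed point of TYZ's embedding matrix** (the transcription of «the unique fixed point of `K_n^×`
in `ℋ`» is certified): `(0·h + 1/4)/(−4N·h + 0) = h`. [cite: TianYuanZhang2017, §3.1 (p0010 L84–L89)] -/
theorem moebius_fixedPoint_hPoint {N : ℕ} (hN : N ≠ 0) : moebius (matTYZ N) (hPoint N) = hPoint N := by
  have hh := sixteen_mul_sq_hPoint hN
  have hN' : (N : ℂ) ≠ 0 := by exact_mod_cast hN
  have hne : -(4 * (N : ℂ)) * hPoint N + 0 ≠ 0 := by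
    rw [add_zero]
    exact mul_ne_zero (neg_ne_zero.mpr (mul_ne_zero (by norm_num) hN')) (hPoint_ne_zero hN)
  have hmo : moebius (matTYZ N) (hPoint N) = (0 * hPoint N + 1 / 4) / (-(4 * (N : ℂ)) * hPoint N + 0) := by
    simp [moebius, matTYZ]
  rw [hmo, div_eq_iff hne]
  linear_combination (1 / 4 : ℂ) * hh

/-- **The first matrix identity of PROOF-A (8.1.2)**: `A·h = i√N/8` (Tian's `A`, TYZ's `h`).
[cite: Tian2014, Prop. 2.1 proof (p0006 L43–L48)] [cite: TianYuanZhang2017, §3.1 (p0010 L84–L89)] [folklore] -/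
theorem moebius_matA_hPoint {N : ℕ} (hN : N ≠ 0) :
    moebius matA (hPoint N) = Complex.I * (Real.sqrt N : ℂ) / 8 := by
  have hs := sqrt_natCast_ne_zero hN
  have hne : 32 * hPoint N ≠ 0 := mul_ne_zero (by norm_num) (hPoint_ne_zero hN)
  rw [moebius_matA, div_eq_iff hne, hPoint]
  field_simp
  linear_combination (-32 : ℂ) * Complex.I_sq

/-- **The second matrix identity of PROOF-A (8.1.2)**: `B·(i√N/8) = (2 + i√N)/8` — Tian's `P` of Def. 2.7 is
`[B·A·h]`. [cite: Tian2014, Def. 2.7 (p0011 L25–L31), Prop. 2.1 proof (p0006 L49–L53)] [folklore] -/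
theorem moebius_matB_eq (N : ℕ) :
    moebius matB (Complex.I * (Real.sqrt N : ℂ) / 8) = (2 + Complex.I * (Real.sqrt N : ℂ)) / 8 := by
  rw [moebius_matB]; ring

/-- `i√N/8 ∈ ℋ`. [cite: Tian2014, Def. 2.7 (p0011 L25–L31)] [folklore] -/
theorem im_I_mul_sqrt_div_pos {N : ℕ} (hN : N ≠ 0) : 0 < (Complex.I * (Real.sqrt N : ℂ) / 8).im := by
  have hs := sqrt_natCast_pos hN
  have : Complex.I * (Real.sqrt N : ℂ) / 8 = ((Real.sqrt N / 8 : ℝ) : ℂ) * Complex.I := by push_cast; ring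
  rw [this]
  simp only [Complex.mul_im, Complex.ofReal_re, Complex.ofReal_im, Complex.I_re, Complex.I_im, mul_one,
    zero_mul, add_zero]
  positivity

/-! ## §2 The `2`-torsion of `E(ℂ)` and the transport of the four `2`-torsion points -/

section TwoTorsion

variable {H : Type} [Field H] [CharZero H]

/-- `E : y² = x³ − x` has split `2`-torsion `−1, 0, 1` over any field of characteristic `0`.
[cite: SilvermanAEC2009, Prop. X.1.4] [folklore] -/
theorem splitTwoTorsion_E :
    ((congruentNumberCurve 1).baseChange H).toAffine.SplitTwoTorsion 0 1 (-1) := by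
  constructor <;> simp [congruentNumberCurve, WeierstrassCurve.baseChange, b₂, b₄, b₆]

/-- **`E(H)[2] = {0, (0,0), (1,0), (−1,0)}`**: a point killed by `2` is one of the four.
[cite: SilvermanAEC2009, Prop. X.1.4] -/
theorem eq_twoTorsion_of_two_nsmul_eq_zero {P : EPoint H} (hP : (2 : ℕ) • P = 0) :
    P = 0 ∨ P = ptZero ∨ P = ptOne ∨ P = ptNegOne := by
  haveI : ((congruentNumberCurve 1).baseChange H).IsElliptic := by
    haveI := isElliptic_congruentNumberCurve one_ne_zero
    infer_instance
  rcases WeierstrassCurve.Affine.Point.eq_zero_or_eq_twoTorsion_of_two_nsmul_eq_zero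
      (splitTwoTorsion_E (H := H)) hP with h | h | h | h
  · exact Or.inl h
  · refine Or.inr (Or.inl ?_)
    rw [h, ptZero]
    simp [WeierstrassCurve.Affine.twoTorsionY, congruentNumberCurve, WeierstrassCurve.baseChange]
  · refine Or.inr (Or.inr (Or.inl ?_))
    rw [h, ptOne]
    simp [WeierstrassCurve.Affine.twoTorsionY, congruentNumberCurve, WeierstrassCurve.baseChange]
  · refine Or.inr (Or.inr (Or.inr ?_))
    rw [h, ptNegOne]
    simp [WeierstrassCurve.Affine.twoTorsionY, congruentNumberCurve, WeierstrassCurve.baseChange]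

variable {K : Type} [Field K] [CharZero K]

/-- The four `2`-torsion points are rational: any `ℚ`-algebra map `H → K` sends `(0,0)` to `(0,0)`.
[cite: Tian2014, Thm. 2.8 (1) (p0011 L39–L40)] [folklore] -/
theorem map_ptZero (f : H →ₐ[ℚ] K) :
    WeierstrassCurve.Affine.Point.map f (ptZero : EPoint H) = (ptZero : EPoint K) := by
  rw [ptZero, ptZero, WeierstrassCurve.Affine.Point.map_some]
  simp

/-- … and `(1,0)` to `(1,0)`. [cite: Tian2014, Thm. 2.8 (2) (p0011 L41)] [folklore] -/
theorem map_ptOne (f : H →ₐ[ℚ] K) :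
    WeierstrassCurve.Affine.Point.map f (ptOne : EPoint H) = (ptOne : EPoint K) := by
  rw [ptOne, ptOne, WeierstrassCurve.Affine.Point.map_some]
  simp

/-- … and `(−1,0)` to `(−1,0)`. [cite: Tian2014, Thm. 2.8 (3) (p0011 L42–L44)] [folklore] -/
theorem map_ptNegOne (f : H →ₐ[ℚ] K) :
    WeierstrassCurve.Affine.Point.map f (ptNegOne : EPoint H) = (ptNegOne : EPoint K) := by
  rw [ptNegOne, ptNegOne, WeierstrassCurve.Affine.Point.map_some]
  simp

end TwoTorsion

/-! ## §3 Appendix (append, g7): uniqueness of TYZ's `h` in `ℋ` -/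

/-- **`h` is the UNIQUE fixed point in `ℋ` of TYZ's embedding matrix**: a point `z` of the upper half plane with
`(0·z + 1/4)/(−4N·z + 0) = z` is `hPoint N = i/(4√N)` («`h ∈ ℋ^{K_n^×}` is the unique fixed point of `K_n^×` in `ℋ`»).
[cite: TianYuanZhang2017, §3.1 (p0010 L84–L89)] -/
theorem eq_hPoint_of_moebius_fixed {N : ℕ} (hN : N ≠ 0) {z : ℂ} (hz : 0 < z.im)
    (hfix : moebius (matTYZ N) z = z) : z = hPoint N := by
  have hN' : (N : ℂ) ≠ 0 := by exact_mod_cast hN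
  have hz0 : z ≠ 0 := fun h => by rw [h] at hz; simp at hz
  have hne : -(4 * (N : ℂ)) * z + 0 ≠ 0 := by
    rw [add_zero]
    exact mul_ne_zero (neg_ne_zero.mpr (mul_ne_zero (by norm_num) hN')) hz0
  have hmo : moebius (matTYZ N) z = (0 * z + 1 / 4) / (-(4 * (N : ℂ)) * z + 0) := by
    simp [moebius, matTYZ]
  rw [hmo, div_eq_iff hne] at hfix
  -- `16 N z² = −1`, so `z² = h²`, so `z = ± h`; the imaginary part decides
  have hh := sixteen_mul_sq_hPoint hN
  have hsq : z ^ 2 = hPoint N ^ 2 := by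
    have h16 : (16 : ℂ) * N ≠ 0 := mul_ne_zero (by norm_num) hN'
    have hz2 : 16 * (N : ℂ) * z ^ 2 = -1 := by linear_combination (4 : ℂ) * hfix
    exact mul_left_cancel₀ h16 (hz2.trans hh.symm)
  rcases sq_eq_sq_iff_eq_or_eq_neg.mp hsq with h | h
  · exact h
  · exfalso
    have him := hPoint_im_pos hN
    rw [h, Complex.neg_im] at hz
    linarith


end Literature.NumberTheory.EllipticCurves.Tian2014

end
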